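import Summits.ABC.IUTFork.Repair.RcatGeiger
import HarnessLib

/-!
# REPAIR-CATALOGUE row RC-322 / RC-327 (Geiger 2026, Prop VII.3 «scaling mismatch») — the located CURRENCY arithmetic, checked

PROOF-ONLY record file (no definition, no `Prop` fact, nothing asserted about print or about the source) of the abc-iut cell, D-0123(C)
REPAIR-CATALOGUE, floating tester abc-iut-rcat-tst-7 (CONSISTENCY / GENUINE-DATA cells of RC-322 and RC-327; source
`paper:doi-10-5281-zenodo-20541632`, bib `Geiger2026Cor312Gap`). Companion of `Repair/RcatGeiger.lean` (p509240) §5.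

WHAT IS CHECKED (pure arithmetic over `ℚ`, `n = l⋆ = (l − 1)/2`, `l = 2n + 1`):
* `avg_sq_labels` — the label average of `j²`: `(∑_{j=1}^{n} j²)/n = (n+1)(2n+1)/6` ([IUTchIV] Thm 1.10 Step (v) (E2) shape; used in the
  cell's per-place Θ-vs-q log-volume gap in PRINT's normalisation, where the q-pilot is the label-free `q̳_v = q_v^{1/2l}` and the Θ-values are
  `q̳_v^{j²}`, [IUTchI] Ex 3.2 (iv), [IUTchIII] Rmk 3.11.1 (i): gap coefficient `c_print(n) := ((n+1)(2n+1)/6 − 1)/(2(2n+1))` in units of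
  `|log|q_v||`);
* `source_coeff_eq` — the SOURCE's j-averaged non-archimedean coefficient of Prop VII.3 (p.12: `R_non^{(l)} = ((l⋆+1)(l⋆−1)/3)·|log q|`, Tate
  parameter `q`, label-weighted q-side `j·log q`, cf. `RcatGeiger.avg_mul_one_sub_self`) factors as
  `c_src(n) := (n+1)(n−1)/3 = [4(n+1)(2n+1)/(2n+5)] · c_print(n)`;
* `source_over_print_gt` — for `n ≥ 2` the conversion factor `4(n+1)(2n+1)/(2n+5)` exceeds `l = 2n+1` (it is `≈ 2l`): the source's
  «O(l²)» obstruction coefficient is print's O(l) per-place gap coefficient times a factor `> l`, the difference being the two located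
  normalisation choices (2l-th root; label-independent q-pilot) recorded in the catalogue's CONSISTENCY cell — ARITHMETIC ONLY; which
  normalisation is «right» is not a question this file asks. Located ≠ adjudicated; no side on [IUTchIII] Cor. 3.12 or on any author;
  nothing asserts abc proved or refuted. [claim: Geiger2026Cor312Gap, status: under-review] [claim: Mochizuki2012, status: disputed]
-/

namespace Summit.ABC.IUTFork.Repair.RcatGeiger

/-- `∑_{j=1}^{n} j² = n(n+1)(2n+1)/6` over `ℚ` (sum over `j ∈ range (n+1)`, the `j = 0` term vanishing). [folklore] -/
theorem sum_sq_labels (n : ℕ) :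
    ∑ j ∈ Finset.range (n + 1), ((j : ℚ) ^ 2) = (n : ℚ) * (n + 1) * (2 * n + 1) / 6 := by
  induction n with
  | zero => simp
  | succ n ih =>
    rw [Finset.sum_range_succ, ih]
    push_cast
    ring

/-- **The label average of `j²`**: `(∑_{j=1}^{n} j²)/n = (n+1)(2n+1)/6` for `n ≠ 0`. [folklore] -/
theorem avg_sq_labels {n : ℕ} (hn : n ≠ 0) :
    (∑ j ∈ Finset.range (n + 1), ((j : ℚ) ^ 2)) / n = ((n : ℚ) + 1) * (2 * n + 1) / 6 := by
  rw [sum_sq_labels]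
  have hn' : (n : ℚ) ≠ 0 := by exact_mod_cast hn
  rw [div_eq_iff hn']
  ring

/-- **The source's Prop VII.3 coefficient against print's per-place gap coefficient**: with `c_print(n) = ((n+1)(2n+1)/6 − 1)/(2(2n+1))`
and `c_src(n) = (n+1)(n−1)/3`, one has `c_src(n) = [4(n+1)(2n+1)/(2n+5)] · c_print(n)` for every `n` (over `ℚ`). [folklore] -/
theorem source_coeff_eq (n : ℕ) :
    ((n : ℚ) + 1) * (n - 1) / 3 =
      (4 * ((n : ℚ) + 1) * (2 * n + 1) / (2 * n + 5)) * ((((n : ℚ) + 1) * (2 * n + 1) / 6 - 1) / (2 * (2 * n + 1))) := by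
  have hn : (0 : ℚ) ≤ n := Nat.cast_nonneg n
  have h1 : (2 * (n : ℚ) + 5) ≠ 0 := ne_of_gt (by linarith)
  have h2 : (2 * (2 * (n : ℚ) + 1)) ≠ 0 := ne_of_gt (by linarith)
  rw [div_mul_div_comm, eq_div_iff (mul_ne_zero h1 h2)]
  ring

/-- **The conversion factor exceeds `l = 2n + 1` once `n ≥ 2`** (`4(n+1)(2n+1) > (2n+1)(2n+5) ⟺ 4n + 4 > 2n + 5`). [folklore] -/
theorem source_over_print_gt {n : ℕ} (hn : 2 ≤ n) :
    (2 * (n : ℚ) + 1) < 4 * ((n : ℚ) + 1) * (2 * n + 1) / (2 * n + 5) := by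
  have hn' : (2 : ℚ) ≤ n := by exact_mod_cast hn
  have hpos : (0 : ℚ) < 2 * n + 5 := by linarith
  rw [lt_div_iff₀ hpos]
  nlinarith

end Summit.ABC.IUTFork.Repair.RcatGeiger
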